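import Summits.AnomalousDissipation.AnomalousDissipation.Theorems.SolenoidalFractalHomogenisationLagrangianStepVmodFlatBlocksEVH
import HarnessLib

/-!
# K1L_D (stmt-AnomalousDissipation-27980): (V_mod) FLAT STAGE — the GRID-PHASE block family «P» (texts of record v2, tenure RULING D28-9)
# (prover ad-k3l-bookkeeping-p1 g10 types on the tenure's instruction; `--kind definition --supports 27980 --as helper`; certifier 3-probe before use)

RULING D28-9 (planner ad-ideate-p1 g28, 12:44Z 2026-08-29, on finding F-k3l10-1): every coarse-label tool of the (ℓ2) lanes carries the carrier-phase
anchor `hphase` (window start `s ∈ (M·W.period/ν)·ℕ`), and the only consumers of the flat stage are `s = 0` / grid objects (`VmodDist.SlowVectorClauseModECW0`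
is `U 0 t`/`T 0 t`; the EulerPieceT consumer is phase-anchored, D27-9′(4)).  Hence the block family is re-cut to GRID STARTS, losing nothing downstream:
* `SlowVectorClauseLossFlatWP` — `CellClauseMod.SlowVectorClauseLossFlatW` with the window start a grid point: binder `∀ j : ℕ, ∀ t, let s := j·(M·W.period/ν);
  s < t → t ≤ Tw →` in place of `∀ s t, 0 ≤ s → s < t → t ≤ Tw →` (conclusion verbatim);
* `BlockBoundP … Px Pζ` — `BlockBound` with the same re-cut (grid start as the binder `j`, instantiate at `j = 0` for the consumer);
* `Bss_textEHP e`, `Bsf_textEVHP e`, `Bfs_textEVHP e`, `Bff_textEVHP e` — the binder lists of `Bss_textEH` / `B??_textEVH` (RULING D27-12) VERBATIM, conclusions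
  over `BlockBoundP`; `lossFlatWP_of_V_textEH e` — the flat-stage target over `SlowVectorClauseLossFlatWP`;
* bridges (general ⇒ grid, so nothing landed is orphaned): `blockBoundP_of_blockBound`, `bssEHP_of_bssEH`, `bsfEVHP_of_bsfEVH`, `bfsEVHP_of_bfsEVH`,
  `bffEVHP_of_bffEVH`, `lossFlatWP_of_lossFlatW`, `lossFlatWP_textEH_of_textEH`;
* the assembly twins `lossFlatWP_of_blockBoundsP_at` (body of `lossFlatW_of_blockBounds_at`, p708xxx, verbatim at a grid start) and
  **`lossFlatWP_of_blocksEVHP : CoarseSupp_text → Bss_textEHP e → Bsf_textEVHP e → Bfs_textEVHP e → Bff_textEVHP e → lossFlatWP_of_V_textEH e`**.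
Lanes: (ss) := p1's `ssMode_grid` road, (fs) := p3's table, (sf) := k3l's grid rows, (ff) := the grid twin from the amplitude iteration.  Definitions +
bookkeeping only; NOT a proof of any block, of `stub_Vmod_EHTthg`, of K1L_D or AD; rung F-D1.A0.
-/

set_option linter.dupNamespace false

noncomputable section

namespace Summit.AnomalousDissipation.AnomalousDissipation.Theorems.SolenoidalFractalHomogenisation.LagrangianStep.VmodFlat

open Literature.Analysis Literature.Analysis.FluidPDE Literature.Analysis.FunctionSpaces
open MeasureTheory Set Filter UnitAddTorus
open scoped ENNReal NNReal InnerProductSpace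
open Summit.AnomalousDissipation.AnomalousDissipation.Theorems.SolenoidalFractalHomogenisation.LagrangianStep.CellClauseMod
open Summit.AnomalousDissipation.AnomalousDissipation.Theorems.SolenoidalFractalHomogenisation.LagrangianStep.LossCurrency
open Summit.AnomalousDissipation.AnomalousDissipation.Theorems.SolenoidalFractalHomogenisation.RealisedQuasiStaticCellLaw

/-! ## §1 The grid-phase clause and block shape -/

/-- **(V_LossFlatW)ᴾ** — `CellClauseMod.SlowVectorClauseLossFlatW` at GRID window starts `s = j·(M·W.period/ν)` (RULING D28-9); conclusion verbatim. -/
def SlowVectorClauseLossFlatWP {k : ℕ} (W : LatticeShear.LatticeWord k) (M : ℝ) (hM : 0 < M) (c : ℝ)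
    (Φ : ℝ → Torus.Visc4 (Fin 3) → Torus.Visc4 (Fin 3)) (lo hi Λ β σ C ν₀ K : ℝ) : Prop :=
  ∀ ν, ∀ hν : ν ∈ Set.Ioo 0 ν₀, ∀ n : ℕ, (⌈K / ν⌉₊ : ℝ) ≤ n → ∀ 𝔸 : Torus.Visc4 (Fin 3),
    Torus.OddSmall 𝔸 (ν * β) → (∃ lam ∈ Set.Icc (1:ℝ) Λ, Torus.NearIso 𝔸 (ν * (lo / lam)) (ν * (hi * lam))) →
    Torus.OddSmall (Φ ν ((1 / ν) • 𝔸)) β → (∃ lam ∈ Set.Icc (1:ℝ) Λ, Torus.NearIso (Φ ν ((1 / ν) • 𝔸)) (lo / lam) (hi * lam)) →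
    ∀ Tw > (0:ℝ), ∀ U T : ℝ → ℝ → (V2 →L[ℝ] V2),
      Torus.IsPropagator Tw (cellField W M hM ν hν.1 n) ((1 / (n:ℝ) ^ 2) • 𝔸) U →
      Torus.IsPropagator Tw (fun _ _ => 0) ((1 / (n:ℝ) ^ 2) • (𝔸 + (c / ν) • Φ ν ((1 / ν) • 𝔸))) T →
    ∀ j : ℕ, ∀ t : ℝ, let s : ℝ := (j : ℝ) * (M * W.period / ν); s < t → t ≤ Tw → ∀ x ζ : V2,
      |⟪U s t x - T s t x, ζ⟫_ℝ|
        ≤ (C * (C * (ν ^ σ + ((⌈K / ν⌉₊ : ℝ) / n) ^ σ) + (min 1 ((M * W.period / ν) / (t - s))) ^ σ))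
          * Real.sqrt (lossFwd (T s t) x) * Real.sqrt (lossAdj (T s t) ζ)

/-- **The common block shape at GRID starts** (`BlockBound` re-cut, RULING D28-9): data restricted by `Px n x`, `Pζ n ζ`. -/
def BlockBoundP {k : ℕ} (W : LatticeShear.LatticeWord k) (M : ℝ) (hM : 0 < M) (c : ℝ)
    (Φ : ℝ → Torus.Visc4 (Fin 3) → Torus.Visc4 (Fin 3)) (lo hi Λ β σ Cb ν₀ K : ℝ) (Px Pζ : ℕ → V2 → Prop) : Prop :=
  ∀ ν, ∀ hν : ν ∈ Set.Ioo 0 ν₀, ∀ n : ℕ, (⌈K / ν⌉₊ : ℝ) ≤ n → ∀ 𝔸 : Torus.Visc4 (Fin 3),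
    Torus.OddSmall 𝔸 (ν * β) → (∃ lam ∈ Set.Icc (1:ℝ) Λ, Torus.NearIso 𝔸 (ν * (lo / lam)) (ν * (hi * lam))) →
    Torus.OddSmall (Φ ν ((1 / ν) • 𝔸)) β → (∃ lam ∈ Set.Icc (1:ℝ) Λ, Torus.NearIso (Φ ν ((1 / ν) • 𝔸)) (lo / lam) (hi * lam)) →
    ∀ Tw > (0:ℝ), ∀ U T : ℝ → ℝ → (V2 →L[ℝ] V2),
      Torus.IsPropagator Tw (cellField W M hM ν hν.1 n) ((1 / (n:ℝ) ^ 2) • 𝔸) U →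
      Torus.IsPropagator Tw (fun _ _ => 0) ((1 / (n:ℝ) ^ 2) • (𝔸 + (c / ν) • Φ ν ((1 / ν) • 𝔸))) T →
    ∀ j : ℕ, ∀ t : ℝ, let s : ℝ := (j : ℝ) * (M * W.period / ν); s < t → t ≤ Tw → ∀ x ζ : V2, Px n x → Pζ n ζ →
      |⟪U s t x - T s t x, ζ⟫_ℝ|
        ≤ (Cb * (Cb * (ν ^ σ + ((⌈K / ν⌉₊ : ℝ) / n) ^ σ) + (min 1 ((M * W.period / ν) / (t - s))) ^ σ))
          * Real.sqrt (lossFwd (T s t) x) * Real.sqrt (lossAdj (T s t) ζ)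

/-! ## §2 The four block texts and the flat-stage target at grid starts (binder lists of RULING D27-12 verbatim) -/

/-- **(ss)ᴾ** — `Bss_textEH e` over `BlockBoundP`. -/
def Bss_textEHP (e : ℝ → ℝ) : Prop := ∀ k (W : LatticeShear.LatticeWord k) (M : ℝ) (hM : 0 < M) (c : ℝ), 0 < c →
  ∀ (Φ : ℝ → Torus.Visc4 (Fin 3) → Torus.Visc4 (Fin 3)) (lo hi Λ β σ C ν₀ K : ℝ),
    0 < lo → lo ≤ 1 → 1 ≤ hi → 1 < Λ → 0 ≤ β → 0 < σ → 0 ≤ C → 0 < ν₀ → ν₀ ≤ 1 → 0 < K →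
    SlowVectorClauseF W M hM c Φ lo hi Λ β σ C ν₀ K →
    (∀ Kb : ℝ, 1 ≤ Kb → ∃ CK : ℝ, 1 ≤ CK ∧ ∃ cK > (0:ℝ), ∃ νh > (0:ℝ), HighLabelDecayW W M hM lo hi Λ β νh Kb CK cK) →
    ∃ C₁ : ℝ, C ≤ C₁ ∧ BlockBoundP W M hM c Φ lo hi Λ β (e σ) C₁ ν₀ K IsSlow IsSlow

/-- **(sf)ᴾ** — `Bsf_textEVH e` over `BlockBoundP`. -/
def Bsf_textEVHP (e : ℝ → ℝ) : Prop := ∀ k (W : LatticeShear.LatticeWord k) (M : ℝ) (hM : 0 < M) (c : ℝ), 0 < c →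
  ∀ (Φ : ℝ → Torus.Visc4 (Fin 3) → Torus.Visc4 (Fin 3)) (lo hi Λ β σ C ν₀ K : ℝ),
    0 < lo → lo ≤ 1 → 1 ≤ hi → 1 < Λ → 0 ≤ β → 0 < σ → 0 ≤ C → 0 < ν₀ → ν₀ ≤ 1 → 0 < K →
    SlowVectorClauseF W M hM c Φ lo hi Λ β σ C ν₀ K →
    (∀ Kb : ℝ, 1 ≤ Kb → ∃ CK : ℝ, 1 ≤ CK ∧ ∃ cK > (0:ℝ), ∃ νh > (0:ℝ), HighLabelDecayW W M hM lo hi Λ β νh Kb CK cK) →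
    ∃ C₂ : ℝ, 0 ≤ C₂ ∧ BlockBoundP W M hM c Φ lo hi Λ β (e σ) C₂ ν₀ K IsSlow IsFast

/-- **(fs)ᴾ** — `Bfs_textEVH e` over `BlockBoundP`. -/
def Bfs_textEVHP (e : ℝ → ℝ) : Prop := ∀ k (W : LatticeShear.LatticeWord k) (M : ℝ) (hM : 0 < M) (c : ℝ), 0 < c →
  ∀ (Φ : ℝ → Torus.Visc4 (Fin 3) → Torus.Visc4 (Fin 3)) (lo hi Λ β σ C ν₀ K : ℝ),
    0 < lo → lo ≤ 1 → 1 ≤ hi → 1 < Λ → 0 ≤ β → 0 < σ → 0 ≤ C → 0 < ν₀ → ν₀ ≤ 1 → 0 < K →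
    SlowVectorClauseF W M hM c Φ lo hi Λ β σ C ν₀ K →
    (∀ Kb : ℝ, 1 ≤ Kb → ∃ CK : ℝ, 1 ≤ CK ∧ ∃ cK > (0:ℝ), ∃ νh > (0:ℝ), HighLabelDecayW W M hM lo hi Λ β νh Kb CK cK) →
    ∃ C₃ : ℝ, 0 ≤ C₃ ∧ BlockBoundP W M hM c Φ lo hi Λ β (e σ) C₃ ν₀ K IsFast IsSlow

/-- **(ff)ᴾ** — `Bff_textEVH e` over `BlockBoundP`. -/
def Bff_textEVHP (e : ℝ → ℝ) : Prop := ∀ k (W : LatticeShear.LatticeWord k) (M : ℝ) (hM : 0 < M) (c : ℝ), 0 < c →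
  ∀ (Φ : ℝ → Torus.Visc4 (Fin 3) → Torus.Visc4 (Fin 3)) (lo hi Λ β σ C ν₀ K : ℝ),
    0 < lo → lo ≤ 1 → 1 ≤ hi → 1 < Λ → 0 ≤ β → 0 < σ → 0 ≤ C → 0 < ν₀ → ν₀ ≤ 1 → 0 < K →
    SlowVectorClauseF W M hM c Φ lo hi Λ β σ C ν₀ K →
    (∀ Kb : ℝ, 1 ≤ Kb → ∃ CK : ℝ, 1 ≤ CK ∧ ∃ cK > (0:ℝ), ∃ νh > (0:ℝ), HighLabelDecayW W M hM lo hi Λ β νh Kb CK cK) →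
    ∃ C₄ : ℝ, 0 ≤ C₄ ∧ BlockBoundP W M hM c Φ lo hi Λ β (e σ) C₄ ν₀ K IsFast IsFast

/-- **The flat-stage targetᴾ** — `lossFlatW_of_V_textEH e` over `SlowVectorClauseLossFlatWP` ((ℓ2)'s output at grid starts). -/
def lossFlatWP_of_V_textEH (e : ℝ → ℝ) : Prop := ∀ k (W : LatticeShear.LatticeWord k) (M : ℝ) (hM : 0 < M) (c : ℝ), 0 < c →
  ∀ (Φ : ℝ → Torus.Visc4 (Fin 3) → Torus.Visc4 (Fin 3)) (lo hi Λ β σ C ν₀ K : ℝ),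
    0 < lo → lo ≤ 1 → 1 ≤ hi → 1 < Λ → 0 ≤ β → 0 < σ → 0 ≤ C → 0 < ν₀ → ν₀ ≤ 1 → 0 < K →
    SlowVectorClauseF W M hM c Φ lo hi Λ β σ C ν₀ K →
    (∀ Kb : ℝ, 1 ≤ Kb → ∃ CK : ℝ, 1 ≤ CK ∧ ∃ cK > (0:ℝ), ∃ νh > (0:ℝ), HighLabelDecayW W M hM lo hi Λ β νh Kb CK cK) →
    ∃ Cm : ℝ, C ≤ Cm ∧ SlowVectorClauseLossFlatWP W M hM c Φ lo hi Λ β (e σ) Cm ν₀ K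

/-! ## §3 Bridges: general phase ⇒ grid phase (one-liners; every landed any-phase theorem feeds the grid family) -/

/-- `BlockBound ⇒ BlockBoundP` (instantiate the general window start at the grid point). -/
theorem blockBoundP_of_blockBound {k : ℕ} {W : LatticeShear.LatticeWord k} {M : ℝ} {hM : 0 < M} {c : ℝ}
    {Φ : ℝ → Torus.Visc4 (Fin 3) → Torus.Visc4 (Fin 3)} {lo hi Λ β σ Cb ν₀ K : ℝ} {Px Pζ : ℕ → V2 → Prop}
    (h : BlockBound W M hM c Φ lo hi Λ β σ Cb ν₀ K Px Pζ) : BlockBoundP W M hM c Φ lo hi Λ β σ Cb ν₀ K Px Pζ := by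
  intro ν hν n hn 𝔸 hodd hwin hΦo hΦw Tw hTw U T hU hT j t s hst htT x ζ hx hζ
  have hs : 0 ≤ s := by
    show (0:ℝ) ≤ (j : ℝ) * (M * W.period / ν)
    exact mul_nonneg (Nat.cast_nonneg j) (div_nonneg (mul_nonneg hM.le
      (Summit.AnomalousDissipation.AnomalousDissipation.Theorems.SolenoidalFractalHomogenisation.PermissibleCarrier.period_pos W).le) hν.1.le)
  exact h ν hν n hn 𝔸 hodd hwin hΦo hΦw Tw hTw U T hU hT s t hs hst htT x ζ hx hζ

/-- `LossFlatW ⇒ LossFlatWP`. -/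
theorem lossFlatWP_of_lossFlatW {k : ℕ} {W : LatticeShear.LatticeWord k} {M : ℝ} {hM : 0 < M} {c : ℝ}
    {Φ : ℝ → Torus.Visc4 (Fin 3) → Torus.Visc4 (Fin 3)} {lo hi Λ β σ C ν₀ K : ℝ}
    (h : SlowVectorClauseLossFlatW W M hM c Φ lo hi Λ β σ C ν₀ K) : SlowVectorClauseLossFlatWP W M hM c Φ lo hi Λ β σ C ν₀ K := by
  intro ν hν n hn 𝔸 hodd hwin hΦo hΦw Tw hTw U T hU hT j t s hst htT x ζ
  have hs : 0 ≤ s := by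
    show (0:ℝ) ≤ (j : ℝ) * (M * W.period / ν)
    exact mul_nonneg (Nat.cast_nonneg j) (div_nonneg (mul_nonneg hM.le
      (Summit.AnomalousDissipation.AnomalousDissipation.Theorems.SolenoidalFractalHomogenisation.PermissibleCarrier.period_pos W).le) hν.1.le)
  exact h ν hν n hn 𝔸 hodd hwin hΦo hΦw Tw hTw U T hU hT s t hs hst htT x ζ

/-- `Bss_textEH e ⇒ Bss_textEHP e`. -/
theorem bssEHP_of_bssEH (e : ℝ → ℝ) (h : Bss_textEH e) : Bss_textEHP e :=
  fun k W M hM c hc Φ lo hi Λ β σ C ν₀ K hlo hlo1 hhi hΛ hβ hσ hC hν₀ hν₀1 hK hV hH => by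
    obtain ⟨C₁, hC₁, B⟩ := h k W M hM c hc Φ lo hi Λ β σ C ν₀ K hlo hlo1 hhi hΛ hβ hσ hC hν₀ hν₀1 hK hV hH
    exact ⟨C₁, hC₁, blockBoundP_of_blockBound B⟩

/-- `Bsf_textEVH e ⇒ Bsf_textEVHP e`. -/
theorem bsfEVHP_of_bsfEVH (e : ℝ → ℝ) (h : Bsf_textEVH e) : Bsf_textEVHP e :=
  fun k W M hM c hc Φ lo hi Λ β σ C ν₀ K hlo hlo1 hhi hΛ hβ hσ hC hν₀ hν₀1 hK hV hH => by
    obtain ⟨C₂, hC₂, B⟩ := h k W M hM c hc Φ lo hi Λ β σ C ν₀ K hlo hlo1 hhi hΛ hβ hσ hC hν₀ hν₀1 hK hV hH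
    exact ⟨C₂, hC₂, blockBoundP_of_blockBound B⟩

/-- `Bfs_textEVH e ⇒ Bfs_textEVHP e`. -/
theorem bfsEVHP_of_bfsEVH (e : ℝ → ℝ) (h : Bfs_textEVH e) : Bfs_textEVHP e :=
  fun k W M hM c hc Φ lo hi Λ β σ C ν₀ K hlo hlo1 hhi hΛ hβ hσ hC hν₀ hν₀1 hK hV hH => by
    obtain ⟨C₃, hC₃, B⟩ := h k W M hM c hc Φ lo hi Λ β σ C ν₀ K hlo hlo1 hhi hΛ hβ hσ hC hν₀ hν₀1 hK hV hH
    exact ⟨C₃, hC₃, blockBoundP_of_blockBound B⟩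

/-- `Bff_textEVH e ⇒ Bff_textEVHP e`. -/
theorem bffEVHP_of_bffEVH (e : ℝ → ℝ) (h : Bff_textEVH e) : Bff_textEVHP e :=
  fun k W M hM c hc Φ lo hi Λ β σ C ν₀ K hlo hlo1 hhi hΛ hβ hσ hC hν₀ hν₀1 hK hV hH => by
    obtain ⟨C₄, hC₄, B⟩ := h k W M hM c hc Φ lo hi Λ β σ C ν₀ K hlo hlo1 hhi hΛ hβ hσ hC hν₀ hν₀1 hK hV hH
    exact ⟨C₄, hC₄, blockBoundP_of_blockBound B⟩

/-- `lossFlatW_of_V_textEH e ⇒ lossFlatWP_of_V_textEH e`. -/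
theorem lossFlatWP_textEH_of_textEH (e : ℝ → ℝ) (h : lossFlatW_of_V_textEH e) : lossFlatWP_of_V_textEH e :=
  fun k W M hM c hc Φ lo hi Λ β σ C ν₀ K hlo hlo1 hhi hΛ hβ hσ hC hν₀ hν₀1 hK hV hH => by
    obtain ⟨Cm, hCm, B⟩ := h k W M hM c hc Φ lo hi Λ β σ C ν₀ K hlo hlo1 hhi hΛ hβ hσ hC hν₀ hν₀1 hK hV hH
    exact ⟨Cm, hCm, lossFlatWP_of_lossFlatW B⟩

/-! ## §4 The flat assembly at grid starts (body of `lossFlatW_of_blockBounds_at` verbatim) -/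

set_option maxHeartbeats 800000 in
/-- **Pointwise flat assemblyᴾ**: the four grid-phase block bounds at output exponent `σ'` with constants `C₁ … C₄ ≥ 0` and (F0) give the grid-phase
flat clause at exponent `σ'` with `Cm = C₁ + C₂ + C₃ + C₄`. -/
theorem lossFlatWP_of_blockBoundsP_at (hF0 : CoarseSupp_text) {k : ℕ} (W : LatticeShear.LatticeWord k) (M : ℝ) (hM : 0 < M) {c : ℝ} (hc : 0 < c)
    (Φ : ℝ → Torus.Visc4 (Fin 3) → Torus.Visc4 (Fin 3)) {lo hi Λ β σ' C₁ C₂ C₃ C₄ ν₀ K : ℝ} (hlo : 0 < lo) (hK : 0 < K)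
    (hC₁ : 0 ≤ C₁) (hC₂ : 0 ≤ C₂) (hC₃ : 0 ≤ C₃) (hC₄ : 0 ≤ C₄)
    (B₁ : BlockBoundP W M hM c Φ lo hi Λ β σ' C₁ ν₀ K IsSlow IsSlow) (B₂ : BlockBoundP W M hM c Φ lo hi Λ β σ' C₂ ν₀ K IsSlow IsFast)
    (B₃ : BlockBoundP W M hM c Φ lo hi Λ β σ' C₃ ν₀ K IsFast IsSlow) (B₄ : BlockBoundP W M hM c Φ lo hi Λ β σ' C₄ ν₀ K IsFast IsFast) :
    SlowVectorClauseLossFlatWP W M hM c Φ lo hi Λ β σ' (C₁ + C₂ + C₃ + C₄) ν₀ K := by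
  intro ν hν n hn 𝔸 hodd hwin hΦo hΦw Tw hTw U T hU hT j t s hst htT x ζ
  have hs : 0 ≤ s := by
    show (0:ℝ) ≤ (j : ℝ) * (M * W.period / ν)
    exact mul_nonneg (Nat.cast_nonneg j) (div_nonneg (mul_nonneg hM.le
      (Summit.AnomalousDissipation.AnomalousDissipation.Theorems.SolenoidalFractalHomogenisation.PermissibleCarrier.period_pos W).le) hν.1.le)
  -- the split at the frequency ball `freqBall (n/4)`
  set A : Set (Fin 3 → ℤ) := ↑(Torus.freqBall (d := Fin 3) (n / 4)) with hA
  have hAsym : ∀ k', k' ∈ A ↔ -k' ∈ A := fun k' => by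
    rw [hA, Finset.mem_coe, Finset.mem_coe, Torus.neg_mem_freqBall]
  obtain ⟨P, hP⟩ := exists_labelProj A hAsym
  have hPoff : ∀ (y : V2) (k' : Fin 3 → ℤ), k' ∉ Torus.freqBall (d := Fin 3) (n / 4) → fc (P y) k' = 0 := by
    intro y k' hk'
    have h := hP y k'
    rw [if_neg (by rwa [hA, Finset.mem_coe] : k' ∉ A)] at h
    exact h
  have hPon : ∀ (y : V2) (k' : Fin 3 → ℤ), k' ∈ Torus.freqBall (d := Fin 3) (n / 4) → fc (P y) k' = fc y k' := by
    intro y k' hk'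
    have h := hP y k'
    rw [if_pos (by rwa [hA, Finset.mem_coe] : k' ∈ A)] at h
    exact h
  set xs : V2 := P x with hxs
  set xf : V2 := x - P x with hxf
  set ζs : V2 := P ζ with hζs
  set ζf : V2 := ζ - P ζ with hζf
  have hx : x = xs + xf := by rw [hxs, hxf]; abel
  have hζ : ζ = ζs + ζf := by rw [hζs, hζf]; abel
  have slow_of : ∀ y : V2, IsSlow n (P y) := fun y k' hk' => hPoff y k' hk'
  have fast_of : ∀ y : V2, IsFast n (y - P y) := fun y k' hk' => by
    rw [fc_sub, hPon y k' hk', sub_self]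
  have hxs_s : IsSlow n xs := slow_of x
  have hxf_f : IsFast n xf := fast_of x
  have hζs_s : IsSlow n ζs := slow_of ζ
  have hζf_f : IsFast n ζf := fast_of ζ
  -- slow and fast pieces are Fourier-disjoint
  have disj : ∀ {y y' : V2}, IsSlow n y → IsFast n y' → ∀ k', fc y k' = 0 ∨ fc y' k' = 0 := by
    intro y y' hy hy' k'
    by_cases hk' : k' ∈ Torus.freqBall (d := Fin 3) (n / 4)
    · exact Or.inr (hy' k' hk')
    · exact Or.inl (hy k' hk')
  -- the coarse member: window of its tensor, support preservation (F0)
  have hn1 : (1:ℝ) ≤ n := by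
    have h1 : (1:ℝ) ≤ ⌈K / ν⌉₊ := by
      have : 0 < K / ν := div_pos hK hν.1
      exact_mod_cast Nat.one_le_iff_ne_zero.2 (Nat.pos_iff_ne_zero.1 (Nat.ceil_pos.2 this))
    exact h1.trans hn
  have hn0 : (0:ℝ) < n := by linarith
  obtain ⟨lam, hlam, hA𝔸⟩ := hwin
  obtain ⟨lam', hlam', hΦn⟩ := hΦw
  have hlam0 : 0 < lam := by linarith [hlam.1]
  have hlam'0 : 0 < lam' := by linarith [hlam'.1]
  have hcν : 0 ≤ c / ν := div_nonneg hc.le hν.1.le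
  have hcoarse : Torus.NearIso ((1 / (n:ℝ) ^ 2) • (𝔸 + (c / ν) • Φ ν ((1 / ν) • 𝔸)))
      ((1 / (n:ℝ) ^ 2) * (ν * (lo / lam) + (c / ν) * (lo / lam'))) ((1 / (n:ℝ) ^ 2) * (ν * (hi * lam) + (c / ν) * (hi * lam'))) :=
    (hA𝔸.add (hΦn.smul hcν)).smul (by positivity)
  have hlo' : 0 < (1 / (n:ℝ) ^ 2) * (ν * (lo / lam) + (c / ν) * (lo / lam')) := by
    have h1 : 0 < ν * (lo / lam) := mul_pos hν.1 (div_pos hlo hlam0)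
    have h2 : 0 ≤ (c / ν) * (lo / lam') := mul_nonneg hcν (div_pos hlo hlam'0).le
    have h3 : 0 < 1 / (n:ℝ) ^ 2 := by positivity
    exact mul_pos h3 (by linarith)
  have hsupp := hF0 Tw _ _ _ hlo' hcoarse T hT s t hs hst.le htT
  -- orthogonality of the split, before and after `T s t` / its adjoint
  have hTs_slow : IsSlow n (T s t xs) := fun k' hk' => (hsupp xs k' (hxs_s k' hk')).1
  have hTf_fast : IsFast n (T s t xf) := fun k' hk' => (hsupp xf k' (hxf_f k' hk')).1
  have hAs_slow : IsSlow n (ContinuousLinearMap.adjoint (T s t) ζs) := fun k' hk' => (hsupp ζs k' (hζs_s k' hk')).2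
  have hAf_fast : IsFast n (ContinuousLinearMap.adjoint (T s t) ζf) := fun k' hk' => (hsupp ζf k' (hζf_f k' hk')).2
  have hox : ⟪xs, xf⟫_ℝ = 0 := inner_eq_zero_of_fc_disjoint (disj hxs_s hxf_f)
  have hoTx : ⟪T s t xs, T s t xf⟫_ℝ = 0 := inner_eq_zero_of_fc_disjoint (disj hTs_slow hTf_fast)
  have hoζ : ⟪ζs, ζf⟫_ℝ = 0 := inner_eq_zero_of_fc_disjoint (disj hζs_s hζf_f)
  have hoAζ : ⟪ContinuousLinearMap.adjoint (T s t) ζs, ContinuousLinearMap.adjoint (T s t) ζf⟫_ℝ = 0 :=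
    inner_eq_zero_of_fc_disjoint (disj hAs_slow hAf_fast)
  -- additivity of the two losses over the split
  have hTc : ∀ y, ‖T s t y‖ ≤ ‖y‖ := hT.norm_le s t
  have hq_add : lossFwd (T s t) x = lossFwd (T s t) xs + lossFwd (T s t) xf := by
    unfold lossFwd; rw [hx]; exact loss_add_of_orthogonal hox hoTx
  have hqs_add : lossAdj (T s t) ζ = lossAdj (T s t) ζs + lossAdj (T s t) ζf := by
    unfold lossAdj; rw [hζ]; exact loss_add_of_orthogonal hoζ hoAζ
  have hq0 : ∀ y, 0 ≤ lossFwd (T s t) y := fun y => loss_nonneg hTc y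
  have hqs0 : ∀ y, 0 ≤ lossAdj (T s t) y := fun y => lossAdj_nonneg hTc y
  -- the four block bounds at the pieces
  have hwin' : ∃ lam ∈ Set.Icc (1:ℝ) Λ, Torus.NearIso 𝔸 (ν * (lo / lam)) (ν * (hi * lam)) := ⟨lam, hlam, hA𝔸⟩
  have hΦw' : ∃ lam ∈ Set.Icc (1:ℝ) Λ, Torus.NearIso (Φ ν ((1 / ν) • 𝔸)) (lo / lam) (hi * lam) := ⟨lam', hlam', hΦn⟩
  have b₁₁ := B₁ ν hν n hn 𝔸 hodd hwin' hΦo hΦw' Tw hTw U T hU hT j t hst htT xs ζs hxs_s hζs_s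
  have b₁₂ := B₂ ν hν n hn 𝔸 hodd hwin' hΦo hΦw' Tw hTw U T hU hT j t hst htT xs ζf hxs_s hζf_f
  have b₂₁ := B₃ ν hν n hn 𝔸 hodd hwin' hΦo hΦw' Tw hTw U T hU hT j t hst htT xf ζs hxf_f hζs_s
  have b₂₂ := B₄ ν hν n hn 𝔸 hodd hwin' hΦo hΦw' Tw hTw U T hU hT j t hst htT xf ζf hxf_f hζf_f
  -- common currency
  set a : ℝ := ν ^ σ' + ((⌈K / ν⌉₊ : ℝ) / n) ^ σ' with ha_def
  set m : ℝ := (min 1 ((M * W.period / ν) / (t - s))) ^ σ' with hm_def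
  have ha0 : 0 ≤ a := by
    have h1 : 0 ≤ ν ^ σ' := Real.rpow_nonneg hν.1.le σ'
    have h2 : 0 ≤ ((⌈K / ν⌉₊ : ℝ) / n) ^ σ' := Real.rpow_nonneg (by positivity) σ'
    rw [ha_def]; linarith
  have hP0 : 0 ≤ (M * W.period / ν) / (t - s) :=
    div_nonneg (div_nonneg (mul_nonneg hM.le
      (Summit.AnomalousDissipation.AnomalousDissipation.Theorems.SolenoidalFractalHomogenisation.PermissibleCarrier.period_pos W).le) hν.1.le)
      (by linarith)
  have hm0 : 0 ≤ m := by rw [hm_def]; exact Real.rpow_nonneg (le_min zero_le_one hP0) σ'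
  have hη0 : ∀ {Cb : ℝ}, 0 ≤ Cb → 0 ≤ Cb * (Cb * a + m) := fun hCb => mul_nonneg hCb (by positivity)
  -- bilinear expansion and the 2×2 bookkeeping
  have hlin : U s t x - T s t x = (U s t xs - T s t xs) + (U s t xf - T s t xf) := by
    rw [hx, map_add, map_add]; abel
  have key := lossBound_add_blocks (v₁ := U s t xs - T s t xs) (v₂ := U s t xf - T s t xf) (ζ₁ := ζs) (ζ₂ := ζf)
    (A := Real.sqrt (lossFwd (T s t) x)) (B := Real.sqrt (lossAdj (T s t) ζ))
    b₁₁ b₁₂ b₂₁ b₂₂ (hη0 hC₁) (hη0 hC₂) (hη0 hC₃) (hη0 hC₄)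
    (Real.sqrt_nonneg _) (Real.sqrt_nonneg _) (Real.sqrt_nonneg _) (Real.sqrt_nonneg _)
    (by rw [Real.sq_sqrt (hq0 xs), Real.sq_sqrt (hq0 xf), Real.sq_sqrt (hq0 x), hq_add])
    (by rw [Real.sq_sqrt (hqs0 ζs), Real.sq_sqrt (hqs0 ζf), Real.sq_sqrt (hqs0 ζ), hqs_add])
  rw [hlin, hζ]
  refine key.trans ?_
  have hsum := eta_sum_le (m := m) hC₁ hC₂ hC₃ hC₄ ha0
  have hAB : 0 ≤ Real.sqrt (lossFwd (T s t) x) * Real.sqrt (lossAdj (T s t) (ζs + ζf)) := by positivity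
  rw [← hζ]
  calc (C₁ * (C₁ * a + m) + C₂ * (C₂ * a + m) + C₃ * (C₃ * a + m) + C₄ * (C₄ * a + m))
        * Real.sqrt (lossFwd (T s t) x) * Real.sqrt (lossAdj (T s t) ζ)
      = (C₁ * (C₁ * a + m) + C₂ * (C₂ * a + m) + C₃ * (C₃ * a + m) + C₄ * (C₄ * a + m))
        * (Real.sqrt (lossFwd (T s t) x) * Real.sqrt (lossAdj (T s t) ζ)) := by ring
    _ ≤ ((C₁ + C₂ + C₃ + C₄) * ((C₁ + C₂ + C₃ + C₄) * a + m))
        * (Real.sqrt (lossFwd (T s t) x) * Real.sqrt (lossAdj (T s t) ζ)) :=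
          mul_le_mul_of_nonneg_right hsum (by positivity)
    _ = ((C₁ + C₂ + C₃ + C₄) * ((C₁ + C₂ + C₃ + C₄) * a + m))
        * Real.sqrt (lossFwd (T s t) x) * Real.sqrt (lossAdj (T s t) ζ) := by ring


/-- **ASSEMBLYᴾ** (RULING D28-9 twin of `lossFlatW_of_blocksEVH`): (F0), (ss)ᴾ and the three EVHᴾ blocks give the grid-phase flat-stage target with the
binder, `Cm = C₁ + C₂ + C₃ + C₄`. -/
theorem lossFlatWP_of_blocksEVHP (e : ℝ → ℝ) (hF0 : CoarseSupp_text) (hss : Bss_textEHP e) (hsf : Bsf_textEVHP e) (hfs : Bfs_textEVHP e)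
    (hff : Bff_textEVHP e) : lossFlatWP_of_V_textEH e := by
  intro k W M hM c hc Φ lo hi Λ β σ C ν₀ K hlo hlo1 hhi hΛ hβ hσ hC hν₀ hν₀1 hK hV hH
  obtain ⟨C₁, hCC₁, B₁⟩ := hss k W M hM c hc Φ lo hi Λ β σ C ν₀ K hlo hlo1 hhi hΛ hβ hσ hC hν₀ hν₀1 hK hV hH
  obtain ⟨C₂, hC₂, B₂⟩ := hsf k W M hM c hc Φ lo hi Λ β σ C ν₀ K hlo hlo1 hhi hΛ hβ hσ hC hν₀ hν₀1 hK hV hH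
  obtain ⟨C₃, hC₃, B₃⟩ := hfs k W M hM c hc Φ lo hi Λ β σ C ν₀ K hlo hlo1 hhi hΛ hβ hσ hC hν₀ hν₀1 hK hV hH
  obtain ⟨C₄, hC₄, B₄⟩ := hff k W M hM c hc Φ lo hi Λ β σ C ν₀ K hlo hlo1 hhi hΛ hβ hσ hC hν₀ hν₀1 hK hV hH
  exact ⟨C₁ + C₂ + C₃ + C₄, by linarith, lossFlatWP_of_blockBoundsP_at hF0 W M hM hc Φ hlo hK (hC.trans hCC₁) hC₂ hC₃ hC₄ B₁ B₂ B₃ B₄⟩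

end Summit.AnomalousDissipation.AnomalousDissipation.Theorems.SolenoidalFractalHomogenisation.LagrangianStep.VmodFlat

end
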